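import Mathlib
import HarnessLib
import Literature.Probability.LatticeModels.TorusFourierProofs
import Summits.HubbardSuperconductivity.HubbardSuperconductivity.Theorems.KLProgrammeKLRegimeSplitBundleV6

/-!
# Route `KLProgramme` — child 3 of the K3 resplit `KLRegimeCountertermV7 := CountertermP2 klPredsV7 klWindowC`
# (stmt-HubbardSuperconductivity-19664): the CONSTANT PIECE of the normal-form extension, part A — the angular mean and the
# symmetrised interpolant (seat hubbard-kl-k3c3-p1, technique «δμ-flow with `klAngularMean` constant piece»)

Child 3's one-volume construction (`CtOneVolume`, `KLProgrammeKLRegimeCountertermV7Volume`) builds the counterterm frame from the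
G-extended local parts `D_n^G(K) = klFrameExtG L μ (ν_n(K))` of `KLProgrammeKLRegimeSplitBundleV6` (Δ13 repair (f1): the angular MEAN of
every extended angular function is carried as a CONSTANT frame — the chemical-potential (δμ) flow of BGM 2003 — and only the mean-free
part meets the flat cutoff).  Every variant of the stage / fixed-point scheme manipulates these objects LINEARLY and needs the constant
piece to be literally a constant frame.  This module (part A; part B = `KLProgrammeKLRegimeCountertermMuFlowExt`) supplies, proved:

* §1 the angular mean `klAngularMean`: value on constants, linearity (under interval-integrability where the Bochner integral needs
  it), the sup bound `|mean f| ≤ B`, the Lipschitz bound, monotonicity, «the mean-free part has mean zero»;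
* §2 the symmetrised interpolant `symInterp` (and its cosine coefficients `torusCosCoeff`): the value formula
  `(symInterp L f)(p) = Σ_x f_c(x)·h_{|x̃₁|,|x̃₂|}(p)` (`eval_symInterp`), hence LINEARITY in the data at the level of values, and — from
  the orthogonality of the torus characters (`sum_torusChar_left`, `torusChar_re` of `TorusFourierProofs`, after identifying the
  centred phase `Σ pᵢx̃ᵢ` with the character's) — **the interpolant of constant data `c` is the constant frame `c`**
  (`eval_symInterp_const`), whose derivatives of every order `≥ 1` vanish (`iteratedFDeriv_evalM_symInterp_const`);
* §3 a constant frame piece is a chemical-potential shift of the frame band: `frameLevel μ C = frameLevel (μ + c) K` when `C = K + c`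
  pointwise (`frameLevel_of_eval_eq_add_const`).

Proofs only (no definitions, no new facts); nothing is asserted about the Hubbard model.  References: BGM 2003 [arXiv:cond-mat/0207210]
§2 (the counterterm `ν̂`, its constant part = chemical-potential renormalisation); BGM 2006 [arXiv:cond-mat/0507686] §2.3; HOME/P2-C4B.md §9.5
(Δ13, fix (f1)); `KLProgrammeKLRegimeSplitBundleV6` module doc (ii)(b).
-/

noncomputable section

namespace Summit.HubbardSuperconductivity.HubbardSuperconductivity.Theorems.KLRegimeSplit

set_option linter.dupNamespace false -- summit = problem name (single-conjunct summit), D-0017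

open Real Finset MeasureTheory
open Literature.MathematicalPhysics.QuantumLattice Literature.Probability.LatticeModels
open Summit.HubbardSuperconductivity.HubbardSuperconductivity.Theorems.KLProgrammeLegKernels
open Summit.HubbardSuperconductivity.HubbardSuperconductivity.Theorems.DispersionFlow

/-! ## §1 The angular mean -/

/-- Unfolding `klAngularMean`. -/
theorem klAngularMean_def (f : ℝ → ℝ) : klAngularMean f = (2 * π)⁻¹ * ∫ θ in (0 : ℝ)..(2 * π), f θ := rfl

/-- **The angular mean of a constant is the constant** (the δμ piece is read off exactly). -/
theorem klAngularMean_const (c : ℝ) : klAngularMean (fun _ => c) = c := by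
  unfold klAngularMean
  rw [intervalIntegral.integral_const, smul_eq_mul]
  have hπ : (2 * π) ≠ 0 := by positivity
  field_simp
  ring

/-- The angular mean of the zero function is `0`. -/
theorem klAngularMean_zero : klAngularMean (fun _ => (0 : ℝ)) = 0 := klAngularMean_const 0

/-- Additivity of the angular mean (interval-integrable profiles). -/
theorem klAngularMean_add {f g : ℝ → ℝ} (hf : IntervalIntegrable f volume 0 (2 * π))
    (hg : IntervalIntegrable g volume 0 (2 * π)) :
    klAngularMean (fun θ => f θ + g θ) = klAngularMean f + klAngularMean g := by
  unfold klAngularMean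
  rw [intervalIntegral.integral_add hf hg, mul_add]

/-- The angular mean of `-f` is `-(mean f)` (no integrability needed). -/
theorem klAngularMean_neg (f : ℝ → ℝ) : klAngularMean (fun θ => -f θ) = -klAngularMean f := by
  unfold klAngularMean
  rw [intervalIntegral.integral_neg, mul_neg]

/-- The angular mean of `f - g` (interval-integrable profiles). -/
theorem klAngularMean_sub {f g : ℝ → ℝ} (hf : IntervalIntegrable f volume 0 (2 * π))
    (hg : IntervalIntegrable g volume 0 (2 * π)) :
    klAngularMean (fun θ => f θ - g θ) = klAngularMean f - klAngularMean g := by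
  unfold klAngularMean
  rw [intervalIntegral.integral_sub hf hg, mul_sub]

/-- Homogeneity of the angular mean (no integrability needed). -/
theorem klAngularMean_const_mul (a : ℝ) (f : ℝ → ℝ) : klAngularMean (fun θ => a * f θ) = a * klAngularMean f := by
  unfold klAngularMean
  rw [intervalIntegral.integral_const_mul]
  ring

/-- Adding a constant to a profile adds it to the mean. -/
theorem klAngularMean_add_const {f : ℝ → ℝ} (hf : IntervalIntegrable f volume 0 (2 * π)) (c : ℝ) :
    klAngularMean (fun θ => f θ + c) = klAngularMean f + c := by
  rw [klAngularMean_add hf intervalIntegrable_const, klAngularMean_const]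

/-- Subtracting a constant from a profile subtracts it from the mean. -/
theorem klAngularMean_sub_const {f : ℝ → ℝ} (hf : IntervalIntegrable f volume 0 (2 * π)) (c : ℝ) :
    klAngularMean (fun θ => f θ - c) = klAngularMean f - c := by
  rw [klAngularMean_sub hf intervalIntegrable_const, klAngularMean_const]

/-- **The mean-free part has mean zero**: `mean (f − mean f) = 0` (what meets the flat cutoff in `klFrameExtG` carries no δμ). -/
theorem klAngularMean_sub_mean (f : ℝ → ℝ) (hf : IntervalIntegrable f volume 0 (2 * π)) :
    klAngularMean (fun θ => f θ - klAngularMean f) = 0 := by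
  rw [klAngularMean_sub_const hf, sub_self]

/-- **Sup bound**: `|f| ≤ B` on `[0, 2π]` gives `|mean f| ≤ B` (no integrability needed: a non-integrable profile has mean `0`,
and `B ≥ |f 0| ≥ 0`). -/
theorem abs_klAngularMean_le {f : ℝ → ℝ} {B : ℝ} (h : ∀ θ ∈ Set.Icc (0 : ℝ) (2 * π), |f θ| ≤ B) :
    |klAngularMean f| ≤ B := by
  unfold klAngularMean
  have hπ : 0 < 2 * π := by positivity
  have hI : ‖∫ θ in (0 : ℝ)..(2 * π), f θ‖ ≤ B * |2 * π - 0| := by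
    refine intervalIntegral.norm_integral_le_of_norm_le_const fun θ hθ => ?_
    rw [Real.norm_eq_abs]
    refine h θ ?_
    rw [Set.uIoc_of_le hπ.le] at hθ
    exact ⟨hθ.1.le, hθ.2⟩
  rw [Real.norm_eq_abs, sub_zero, abs_of_pos hπ] at hI
  rw [abs_mul, abs_inv, abs_of_pos hπ]
  calc (2 * π)⁻¹ * |∫ θ in (0 : ℝ)..(2 * π), f θ| ≤ (2 * π)⁻¹ * (B * (2 * π)) := by gcongr
    _ = B := by field_simp

/-- Sup bound, everywhere form. -/
theorem abs_klAngularMean_le' {f : ℝ → ℝ} {B : ℝ} (h : ∀ θ, |f θ| ≤ B) : |klAngularMean f| ≤ B :=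
  abs_klAngularMean_le fun θ _ => h θ

/-- **Lipschitz bound**: `|f − g| ≤ B` on `[0, 2π]` gives `|mean f − mean g| ≤ B` (interval-integrable profiles). -/
theorem abs_klAngularMean_sub_le {f g : ℝ → ℝ} {B : ℝ} (hf : IntervalIntegrable f volume 0 (2 * π))
    (hg : IntervalIntegrable g volume 0 (2 * π)) (h : ∀ θ ∈ Set.Icc (0 : ℝ) (2 * π), |f θ - g θ| ≤ B) :
    |klAngularMean f - klAngularMean g| ≤ B := by
  rw [← klAngularMean_sub hf hg]
  exact abs_klAngularMean_le h

/-- Monotonicity of the angular mean (interval-integrable profiles). -/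
theorem klAngularMean_mono {f g : ℝ → ℝ} (hf : IntervalIntegrable f volume 0 (2 * π))
    (hg : IntervalIntegrable g volume 0 (2 * π)) (h : ∀ θ ∈ Set.Icc (0 : ℝ) (2 * π), f θ ≤ g θ) :
    klAngularMean f ≤ klAngularMean g := by
  unfold klAngularMean
  have hπ : 0 < 2 * π := by positivity
  exact mul_le_mul_of_nonneg_left (intervalIntegral.integral_mono_on hπ.le hf hg h) (inv_nonneg.mpr hπ.le)

/-- **Splitting a profile**: `f = mean f + (f − mean f)` pointwise — the δμ piece plus the mean-free piece. -/
theorem klAngularMean_add_sub_self (f : ℝ → ℝ) (θ : ℝ) : f θ = klAngularMean f + (f θ - klAngularMean f) := by ring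

/-! ## §2 The symmetrised interpolant: value formula, linearity, constants -/

section Interp

variable (L : ℕ) [NeZero L]

/-- The centred phase `pᵢ·x̃ᵢ` differs from the representative phase `pᵢ·xᵢ` by an integer multiple of `2π`
(`x̃ = valMinAbs ≡ val (mod L)` and `pᵢ·L = 2π·kᵢ`). -/
theorem exists_latticeMomentum_mul_valMinAbs (k x : TorusSite 2 L) (i : Fin 2) :
    ∃ z : ℤ, latticeMomentum L k i * ((x i).valMinAbs : ℝ) =
      latticeMomentum L k i * ((x i).val : ℝ) + z * (2 * π) := by
  have hcast : (((x i).valMinAbs : ℤ) : ZMod L) = (((x i).val : ℤ) : ZMod L) := by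
    rw [ZMod.coe_valMinAbs, Int.cast_natCast, ZMod.natCast_zmod_val]
  obtain ⟨c, hc⟩ := (ZMod.intCast_eq_intCast_iff_dvd_sub _ _ _).mp hcast
  refine ⟨-((k i).val * c), ?_⟩
  have hL : (L : ℝ) ≠ 0 := by exact_mod_cast NeZero.ne L
  have hv : ((x i).valMinAbs : ℝ) = ((x i).val : ℝ) - (L : ℝ) * (c : ℝ) := by
    have := congrArg (fun t : ℤ => (t : ℝ)) hc
    push_cast at this
    linarith
  rw [hv]
  simp only [latticeMomentum]
  field_simp
  push_cast
  ring

/-- **The lattice cosine with centred representatives is the real part of the torus character** `χ_k(x)`. -/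
theorem cos_sum_latticeMomentum_mul_valMinAbs (k x : TorusSite 2 L) :
    Real.cos (∑ i : Fin 2, latticeMomentum L k i * ((x i).valMinAbs : ℝ)) = (torusChar k x).re := by
  rw [torusChar_re]
  choose z hz using exists_latticeMomentum_mul_valMinAbs L k x
  rw [Finset.sum_congr rfl fun i _ => hz i, Finset.sum_add_distrib, ← Finset.sum_mul]
  have : (∑ i : Fin 2, (z i : ℝ)) = ((∑ i : Fin 2, z i : ℤ) : ℝ) := by push_cast; rfl
  rw [this, Real.cos_add_int_mul_two_pi]

/-- **Orthogonality**: `Σ_{k⃗} cos(p_{k⃗}·x̃) = L²` for `x = 0` and `0` otherwise (from `sum_torusChar_left`). -/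
theorem sum_cos_sum_latticeMomentum_mul_valMinAbs (x : TorusSite 2 L) :
    ∑ k : TorusSite 2 L, Real.cos (∑ i : Fin 2, latticeMomentum L k i * ((x i).valMinAbs : ℝ)) =
      if x = 0 then (L : ℝ) ^ 2 else 0 := by
  simp_rw [cos_sum_latticeMomentum_mul_valMinAbs]
  rw [← Complex.re_sum, sum_torusChar_left]
  split_ifs
  · norm_cast
  · simp

/-- **The cosine coefficients of constant data**: `c` at `x = 0`, `0` elsewhere. -/
theorem torusCosCoeff_const (c : ℝ) (x : TorusSite 2 L) :
    torusCosCoeff L (fun _ => c) x = if x = 0 then c else 0 := by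
  unfold torusCosCoeff
  rw [← Finset.mul_sum, sum_cos_sum_latticeMomentum_mul_valMinAbs]
  have hL : (L : ℝ) ≠ 0 := by exact_mod_cast NeZero.ne L
  split_ifs
  · field_simp
  · simp

/-- The cosine coefficients are additive in the data. -/
theorem torusCosCoeff_add (f g : TorusSite 2 L → ℝ) (x : TorusSite 2 L) :
    torusCosCoeff L (fun k => f k + g k) x = torusCosCoeff L f x + torusCosCoeff L g x := by
  unfold torusCosCoeff
  rw [← mul_add, ← Finset.sum_add_distrib]
  congr 1
  exact Finset.sum_congr rfl fun k _ => by ring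

/-- The cosine coefficients are homogeneous in the data. -/
theorem torusCosCoeff_const_mul (a : ℝ) (f : TorusSite 2 L → ℝ) (x : TorusSite 2 L) :
    torusCosCoeff L (fun k => a * f k) x = a * torusCosCoeff L f x := by
  unfold torusCosCoeff
  rw [Finset.mul_sum, Finset.mul_sum, Finset.mul_sum]
  exact Finset.sum_congr rfl fun k _ => by ring

/-- The cosine coefficients of `-f`. -/
theorem torusCosCoeff_neg (f : TorusSite 2 L → ℝ) (x : TorusSite 2 L) :
    torusCosCoeff L (fun k => -f k) x = -torusCosCoeff L f x := by
  have h := torusCosCoeff_const_mul L (-1) f x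
  simp only [neg_mul, one_mul] at h
  exact h

/-- The cosine coefficients of `f - g`. -/
theorem torusCosCoeff_sub (f g : TorusSite 2 L → ℝ) (x : TorusSite 2 L) :
    torusCosCoeff L (fun k => f k - g k) x = torusCosCoeff L f x - torusCosCoeff L g x := by
  simp only [sub_eq_add_neg]
  rw [← torusCosCoeff_neg, ← torusCosCoeff_add]

/-- The centred representative has absolute value `≤ L`, so its index lies in the coefficient square of `symInterp`. -/
theorem natAbs_valMinAbs_mem_range (x : TorusSite 2 L) (i : Fin 2) : (x i).valMinAbs.natAbs ∈ range (L + 1) :=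
  Finset.mem_range.mpr (Nat.lt_succ_of_le ((ZMod.natAbs_valMinAbs_le (x i)).trans (Nat.div_le_self _ _)))

/-- **Value formula of the symmetrised interpolant**: `(symInterp L f)(p) = Σ_x f_c(x) · h_{|x̃₁|,|x̃₂|}(p)` — each site contributes its
cosine coefficient times the harmonic indexed by its centred representative. -/
theorem eval_symInterp (f : TorusSite 2 L → ℝ) (p : Fin 2 → ℝ) :
    (symInterp L f).eval p = ∑ x : TorusSite 2 L,
      torusCosCoeff L f x * TrigPolyC4v.harmonic (x 0).valMinAbs.natAbs (x 1).valMinAbs.natAbs p := by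
  rw [TrigPolyC4v.eval_def]
  show ∑ m ∈ range (L + 1), ∑ n ∈ range (L + 1), (∑ x : TorusSite 2 L,
      (if ((x 0).valMinAbs.natAbs = m ∧ (x 1).valMinAbs.natAbs = n) then torusCosCoeff L f x else 0)) *
        TrigPolyC4v.harmonic m n p = _
  simp_rw [Finset.sum_mul, ite_mul, zero_mul]
  rw [Finset.sum_congr rfl fun m _ => Finset.sum_comm, Finset.sum_comm]
  refine Finset.sum_congr rfl fun x _ => ?_
  rw [Finset.sum_eq_single_of_mem _ (natAbs_valMinAbs_mem_range L x 0) fun m _ hm =>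
    Finset.sum_eq_zero fun n _ => if_neg fun h => hm h.1.symm]
  rw [Finset.sum_eq_single_of_mem _ (natAbs_valMinAbs_mem_range L x 1) fun n _ hn => if_neg fun h => hn h.2.symm]
  rw [if_pos ⟨rfl, rfl⟩]

/-- **Linearity of the interpolant at the level of values**: additivity. -/
theorem eval_symInterp_add (f g : TorusSite 2 L → ℝ) (p : Fin 2 → ℝ) :
    (symInterp L (fun k => f k + g k)).eval p = (symInterp L f).eval p + (symInterp L g).eval p := by
  simp only [eval_symInterp, torusCosCoeff_add, add_mul, Finset.sum_add_distrib]

/-- Homogeneity of the interpolant at the level of values. -/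
theorem eval_symInterp_const_mul (a : ℝ) (f : TorusSite 2 L → ℝ) (p : Fin 2 → ℝ) :
    (symInterp L (fun k => a * f k)).eval p = a * (symInterp L f).eval p := by
  simp only [eval_symInterp, torusCosCoeff_const_mul, mul_assoc, Finset.mul_sum]

/-- The interpolant of `-f` at the level of values. -/
theorem eval_symInterp_neg (f : TorusSite 2 L → ℝ) (p : Fin 2 → ℝ) :
    (symInterp L (fun k => -f k)).eval p = -(symInterp L f).eval p := by
  simp only [eval_symInterp, torusCosCoeff_neg, neg_mul, Finset.sum_neg_distrib]

/-- The interpolant of `f - g` at the level of values. -/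
theorem eval_symInterp_sub (f g : TorusSite 2 L → ℝ) (p : Fin 2 → ℝ) :
    (symInterp L (fun k => f k - g k)).eval p = (symInterp L f).eval p - (symInterp L g).eval p := by
  simp only [eval_symInterp, torusCosCoeff_sub, sub_mul, Finset.sum_sub_distrib]

/-- **The interpolant of constant data is the constant frame**: `(symInterp L (fun _ => c))(p) = c` for every continuum momentum `p`
(only the site `x = 0` carries a coefficient, against the harmonic `h_{0,0} = 1`).  The δμ piece of a normal-form frame is a genuine
chemical-potential shift, with no interpolation error. -/
theorem eval_symInterp_const (c : ℝ) (p : Fin 2 → ℝ) : (symInterp L (fun _ => c)).eval p = c := by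
  rw [eval_symInterp]
  simp_rw [torusCosCoeff_const, ite_mul, zero_mul]
  rw [Finset.sum_ite_eq']
  simp

/-- The interpolant of zero data vanishes. -/
theorem eval_symInterp_zero (p : Fin 2 → ℝ) : (symInterp L (fun _ => (0 : ℝ))).eval p = 0 := eval_symInterp_const L 0 p

/-- Adding a constant to the data adds the constant frame: `symInterp (f + c) = symInterp f + c` at the level of values. -/
theorem eval_symInterp_add_const (f : TorusSite 2 L → ℝ) (c : ℝ) (p : Fin 2 → ℝ) :
    (symInterp L (fun k => f k + c)).eval p = (symInterp L f).eval p + c := by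
  rw [eval_symInterp_add L f (fun _ => c), eval_symInterp_const]

/-- The interpolant of constant data on `Momentum` is the constant function. -/
theorem evalM_symInterp_const (c : ℝ) : evalM (symInterp L (fun _ => c)) = fun _ => c :=
  funext fun q => eval_symInterp_const L c (WithLp.ofLp q)

/-- **All derivatives of order `≥ 1` of the constant frame vanish** (the δμ piece is free in clause (ii) of `FrameOK` and in every
derivative clause of the two-leg sizes). -/
theorem iteratedFDeriv_evalM_symInterp_const (c : ℝ) {j : ℕ} (hj : j ≠ 0) (q : Momentum) :
    iteratedFDeriv ℝ j (evalM (symInterp L (fun _ => c))) q = 0 := by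
  rw [evalM_symInterp_const, iteratedFDeriv_const_of_ne hj]
  rfl

/-- The zeroth derivative of the constant frame has norm `|c|`. -/
theorem norm_iteratedFDeriv_zero_evalM_symInterp_const (c : ℝ) (q : Momentum) :
    ‖iteratedFDeriv ℝ 0 (evalM (symInterp L (fun _ => c))) q‖ = |c| := by
  rw [norm_iteratedFDeriv_zero, evalM_symInterp_const, Real.norm_eq_abs]

end Interp

/-! ## §3 A constant frame piece is a chemical-potential shift -/

/-- **δμ is a μ-shift of the frame band**: if `C = K + c` pointwise then `e_C` at level `μ` is `e_K` at level `μ + c`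
(`frameLevel μ C = frameLevel (μ + c) K`), so every geometric statement about the frame band (`GeomConstants`, clause (i) of
`FrameOK`, the Fermi curve) sees the counterterm's constant piece only through the shifted chemical potential. -/
theorem frameLevel_of_eval_eq_add_const {K C : TrigPolyC4v} {c μ : ℝ} (h : ∀ p, C.eval p = K.eval p + c) :
    frameLevel μ C = frameLevel (μ + c) K := by
  funext q
  simp only [frameLevel, h]
  ring

/-- The same for the frame shift: `D_C = D_K − c`. -/
theorem frameShift_of_eval_eq_add_const {K C : TrigPolyC4v} {c : ℝ} (h : ∀ p, C.eval p = K.eval p + c) :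
    frameShift C = fun q => frameShift K q - c := by
  funext q
  simp only [frameShift, h]
  ring

end Summit.HubbardSuperconductivity.HubbardSuperconductivity.Theorems.KLRegimeSplit

end
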